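import Summits.Parity.GeneralizedHardyLittlewood.Theses.PrimeLevelFamEdge

/-!
# Route `PrimeLevelFamEdge`, assembly item `Assembly` (stmt-Parity-26575) — re-land for route rev 8

`Assembly` is literally the curried form of the route's deciding theorem `closes`; a prover hand lands
this file as `Summits/Parity/GeneralizedHardyLittlewood/Theorems/PrimeLevelFamEdgeAssembly.lean`.
(ls-ref-1 g4, refuter pre-read 2026-08-27, re-cut for route rev 2 commit ceb26ab3f81d; re-cut for rev 3
(ls-Bfam-plan g3: K_B := `FirstMomentPrinted → C′`, `closes` with SEVEN hypotheses) — a prover hand re-lands it.)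
Re-landed for route rev 4 (R2-G44 repair, shape (α), ls-Bfam-plan g5): the Petersson slot of `Assembly` /
`closes` is the NEW support item `PeterssonBoundPrinted`
(:= `KowalskiMichel2000.kowalskiMichel2000_peterssonBound`, the printed display in its printed range);
the refuted-as-typed `PeterssonPrinted` (stmt-Parity-20012) is no longer an antecedent. (ls-Bfam-prover-1 g3.)
Re-landed for route rev 8 (C′ re-point, ls-Bfam-plan g7, 2026-08-28; Theses rev 8 commit 6955913a3d7a /
rev 9 49d6475e5c64): the two Iwaniec–Sarnak slots of `Assembly` / `closes` are the NEW support items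
`TwistedHalfPrintedSqfreeLevel` (:= `IwaniecSarnak.iwaniec2006_twistedHalf_sqfreeLevel`) and
`MixedMomentPrintedSqfreeLevel` (:= `IwaniecSarnak.iwaniec2006_mixedMomentOverMass_sqfreeLevel`) — the
level-restricted facts («`N` square-free and `φ(N) ∼ N`», p610493) superseding the over-strong records
`TwistedHalfPrinted` / `MixedMomentPrinted` (stmt-Parity-20010 and stmt-Parity-20011, now asides). The proof term is
unchanged (binders by position).
-/

namespace Summit.Parity.GeneralizedHardyLittlewood.Theses.PrimeLevelFamEdge

/-- `Assembly` holds: it is the deciding theorem `closes` (rev 8: seven hypotheses — K_A, K_B, the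
printed first-moment fact `FirstMomentPrinted`, Lapid–Rallis non-negativity, the two LEVEL-RESTRICTED
Iwaniec–Sarnak facts `TwistedHalfPrintedSqfreeLevel` / `MixedMomentPrintedSqfreeLevel`, and the repaired
Petersson bound `PeterssonBoundPrinted`), curried; the assembly item's fourth hypothesis
`EdgeOfBeyondDiagonalValue` (item 20436, `aside`) is not needed. -/
theorem assembly_holds : Assembly :=
  -- buildfix (bf3-g30, class (i) drift): route rev 10 (2026-08-28T22:18Z) DISCHARGED the binder
  -- `hMix : MixedMomentPrintedSqfreeLevel` of `closes` (six hypotheses now); `Assembly` keeps its eight,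
  -- so `hMix` is simply no longer forwarded. Statement (`Assembly` by name) unchanged.
  fun hA hB hF _hS hLR hTw _hMix hP => closes hA hB hF hLR hTw hP

end Summit.Parity.GeneralizedHardyLittlewood.Theses.PrimeLevelFamEdge
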